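import Literature.NumberTheory.Automorphic.QuadraticHeckeCharacterCM          -- ★ `quadraticHeckeCharCM` (`ω_{L∕L⁺}`), `cmQuadraticGenerator_spec`, `quadraticHeckeCharCM_apply_eq_one_iff`
import Literature.NumberTheory.Automorphic.QuadraticIdelicNormRange           -- ★ `range_ideleRelNorm_eq_normIdeles` (O'Meara 65:2), `ideleGalNorm_eq_mul_smul_of_apply_eq_neg`
import Literature.NumberTheory.GaloisRepresentations.CMTypeHeckeCharacter     -- ★ `HeckeCharacter.galConj` (`χ ∘ σ`), `galConj_apply`
import HarnessLib

/-!
# [Rogawski1990 §4.9 p. 54; §13.1 p. 199] A Hecke character of the CM field `L` whose restriction to `𝕀_{L⁺}` is `ω_{L∕L⁺}` is CONJUGATE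
# SELF-DUAL: `μ ∘ c = μ⁻¹` — the guard `hdual` of the explicit transfer factor from the closed letters' guard `hμω`

Topic `NumberTheory/GaloisRepresentations`; namespace `Literature.NumberTheory.GaloisRepresentations`.  THEOREMS ONLY (no definition, no instance,
no notation, no named fact, no `sorry`).  Cell `pub/hodgecm-mathlib`, crux H413 = stmt-HodgeConjecture-24833, brick «hdual-of-ω» (A-p13 (g29) 00:46:25Z
(n3); LEAD F0P3a-plan (g8) WORD T7-53 (3)); seat F0P3-p01 (g12).  HONEST LABEL: HC_CM is proved only modulo the printed citations until rung 0 closes;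
this file discharges none of them — it converts one GUARD into another.

THE POINT.  Rogawski's endoscopic datum for `H = U(2) × U(1) ⊂ U(3)` is a character `μ` of `𝕀_E ∕ E^×` whose restriction to `𝕀_F` is `ω_{E∕F}`, the
quadratic character of `E∕F` (§4.9 p. 54: «Fix a character `μ` of `I_E ∕ E^*` whose restriction to `I_F` is `ω_{E∕F}`»; §13.1 p. 199).  The CLOSED letters of
the rung-0 line (★ `UnitFundamentalLemmaExplicitClosed`, ★ `LocalTransferExplicitClosed`, `stub_QCM`, …) carry exactly this guard as
`hμω : ∀ x : 𝕀_{L⁺}, μ (x_L) = ω_{L∕L⁺}(x)`.  The split-place computations of the explicit factor (★ `FinExplicitTransferFactorSplitPlaceTau`, «B6»; ★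
`FinExplicitTransferFactorInertPlace`) are stated under the a-priori WEAKER guard `hdual : HeckeCharacter.galConj c μ = μ⁻¹` («`μ` is conjugate
self-dual», `μ(ȳ) = μ(y)⁻¹`).  This file derives `hdual` from `hμω`: for `y ∈ 𝕀_L`, `y · ȳ = (N_{L∕L⁺} y)_L` (★ `AdeleRing.ideleBaseChange_ideleRelNorm` + ★
`ideleGalNorm_eq_mul_smul_of_apply_eq_neg`), so `μ(y) μ(ȳ) = ω_{L∕L⁺}(N_{L∕L⁺} y) = 1` because a global norm is a local norm everywhere (★
`range_ideleRelNorm_eq_normIdeles`, O'Meara 65:2) and `ω_{L∕L⁺}` is trivial on `P_{L⁺} · N 𝕀_L` (★ `quadraticHeckeCharCM_apply_eq_one_iff`).  Unitarity of `μ`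
is NOT needed.

* **`HeckeCharacter.galConj_eq_inv_of_restrict_eq_quadraticHeckeCharCM`** — `hμω ⇒ galConj (complexConj L) μ = μ⁻¹` (the `hdual` binder of «B6» ∕
  «D-N7s-G2» ∕ «B6-inert», discharged from the closed letters' guard);
* `HeckeCharacter.apply_mul_apply_smul_eq_one_of_restrict_eq_quadraticHeckeCharCM` — the pointwise form `μ(y) · μ(c • y) = 1`;
* `HeckeCharacter.apply_smul_eq_inv_of_restrict_eq_quadraticHeckeCharCM` — `μ(c • y) = μ(y)⁻¹`.

## References
* [Rogawski1990] J. D. Rogawski, *Automorphic Representations of Unitary Groups in Three Variables*, Ann. of Math. Stud. 123 (1990): §4.9 p. 54; §13.1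
  Prop. 13.1.4 p. 199.
* [Omeara1963] O. T. O'Meara, *Introduction to Quadratic Forms* (1963): §65A Example 65:2.
* [CasselsFrohlichANT1967] J. W. S. Cassels, A. Fröhlich (eds.), *Algebraic Number Theory* (1967): Ch. VII §7.1.
-/

set_option autoImplicit false

noncomputable section

open NumberField IsDedekindDomain
open Literature.NumberTheory.Automorphic

namespace Literature.NumberTheory.GaloisRepresentations

variable (L : Type) [Field L] [NumberField L] [IsCMField L]

/-- **`μ(y) · μ(ȳ) = 1` for a Hecke character of `L` restricting to `ω_{L∕L⁺}` on `𝕀_{L⁺}`**: `y · ȳ = (N_{L∕L⁺} y)_L` (★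
`AdeleRing.ideleBaseChange_ideleRelNorm`, ★ `ideleGalNorm_eq_mul_smul_of_apply_eq_neg` at `α` with `c α = −α`, `α² = θ`, ★ `cmQuadraticGenerator_spec`), and
`ω_{L∕L⁺}` kills global norms (★ `range_ideleRelNorm_eq_normIdeles` — O'Meara 65:2: a global norm from `L = L⁺(√θ)` is a local norm at every place —
and ★ `quadraticHeckeCharCM_apply_eq_one_iff`).  Print: «Fix a character `μ` of `I_E ∕ E^*` whose restriction to `I_F` is `ω_{E∕F}`» (§4.9 p. 54).
[cite: Rogawski1990, §4.9 p. 54; §13.1 Prop. 13.1.4 p. 199] [cite: Omeara1963, §65A Example 65:2] -/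
theorem HeckeCharacter.apply_mul_apply_smul_eq_one_of_restrict_eq_quadraticHeckeCharCM (μ : HeckeCharacter L)
    (hμω : ∀ x : ideleGroup ↥(maximalRealSubfield L),
      μ (AdeleRing.ideleBaseChange (↥(maximalRealSubfield L)) L x) = quadraticHeckeCharCM L x)
    (y : ideleGroup L) :
    μ y * μ (IsCMField.complexConj L • y) = 1 := by
  obtain ⟨α, hα0, hcα, hsq⟩ := cmQuadraticGenerator_spec L
  have hN : y * IsCMField.complexConj L • y =
      AdeleRing.ideleBaseChange (↥(maximalRealSubfield L)) L (AdeleRing.ideleRelNorm (↥(maximalRealSubfield L)) L y) := by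
    rw [AdeleRing.ideleBaseChange_ideleRelNorm, ideleGalNorm_eq_mul_smul_of_apply_eq_neg (IsCMField.complexConj L) hcα hα0]
  rw [← map_mul, hN, hμω, quadraticHeckeCharCM_apply_eq_one_iff]
  refine Subgroup.mem_sup_right ?_
  rw [← range_ideleRelNorm_eq_normIdeles (IsCMField.complexConj L) hcα hα0 (d := (cmQuadraticGenerator L : ↥(maximalRealSubfield L)))
    (by rw [← sq]; exact hsq)]
  exact ⟨y, rfl⟩

/-- **`μ(ȳ) = μ(y)⁻¹`** — pointwise conjugate self-duality of a Hecke character of `L` restricting to `ω_{L∕L⁺}` on `𝕀_{L⁺}`.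
[cite: Rogawski1990, §4.9 p. 54; §13.1 Prop. 13.1.4 p. 199] [cite: Omeara1963, §65A Example 65:2] -/
theorem HeckeCharacter.apply_smul_eq_inv_of_restrict_eq_quadraticHeckeCharCM (μ : HeckeCharacter L)
    (hμω : ∀ x : ideleGroup ↥(maximalRealSubfield L),
      μ (AdeleRing.ideleBaseChange (↥(maximalRealSubfield L)) L x) = quadraticHeckeCharCM L x)
    (y : ideleGroup L) :
    μ (IsCMField.complexConj L • y) = (μ y)⁻¹ :=
  eq_inv_of_mul_eq_one_right (HeckeCharacter.apply_mul_apply_smul_eq_one_of_restrict_eq_quadraticHeckeCharCM L μ hμω y)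

/-- **«hdual-of-ω»: `μ|_{𝕀_{L⁺}} = ω_{L∕L⁺}` ⇒ `μ ∘ c = μ⁻¹`** (★ `HeckeCharacter.galConj`) — the guard `hdual` of ★ `FinExplicitTransferFactorSplitPlaceTau`
(«B6») and of the «D-N7s-G2» ∕ «B6-inert» heads, DISCHARGED from the guard `hμω` the closed rung-0 letters carry (★ `UnitFundamentalLemmaExplicitClosed`,
★ `LocalTransferExplicitClosed`); unitarity of `μ` is not used.  This is the term the N7∕N6 junction (★ `UnitFundamentalLemmaOffFiniteSetAssembly`)
threads when composing the per-place split identity under the closed letter's prefix. [cite: Rogawski1990, §4.9 p. 54; §13.1 Prop. 13.1.4 p. 199]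
[cite: Omeara1963, §65A Example 65:2] -/
theorem HeckeCharacter.galConj_eq_inv_of_restrict_eq_quadraticHeckeCharCM (μ : HeckeCharacter L)
    (hμω : ∀ x : ideleGroup ↥(maximalRealSubfield L),
      μ (AdeleRing.ideleBaseChange (↥(maximalRealSubfield L)) L x) = quadraticHeckeCharCM L x) :
    HeckeCharacter.galConj (IsCMField.complexConj L) μ = μ⁻¹ :=
  HeckeCharacter.ext fun y => by
    rw [HeckeCharacter.galConj_apply, HeckeCharacter.inv_apply]
    exact HeckeCharacter.apply_smul_eq_inv_of_restrict_eq_quadraticHeckeCharCM L μ hμω y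

end Literature.NumberTheory.GaloisRepresentations

end
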